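import Summits.BirchSwinnertonDyer.Rank1Residual.ManinAdditive.CuspidalKummerCubeDescent
import HarnessLib
import HarnessLib.Audit.Tags

/-!
# LAW₃ by cube-root descent AT LEVEL `N`: the open leaf P79 sharpened to `G0 ∧ G1`

TYPER NOTE (typer g19, T-an-39 addendum (c), FILE A2).  SOURCE = HOME/an/g36/CubeExponentLawLevelN-an-g36.lean sha16 8f27e37793c0373e
(166 l.; an: rc 0 · 0 err · 0 warn in Sim3 af706e4333e169a7; BC7 HOME/an/g36/g36-bc7-levelN.out 3/3 CLEAN), landed VERBATIM except this note
and two one-line docstrings.  Imports ONLY the landed leaf `CuspidalKummerCubeDescent` (p715203) — ROUTE-INDEPENDENT.  The two `@[conjecture]`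
leaves G1 `CubeRepSecondDescent` (E-an-166) / G0 `KummerCubeSeriesNotCubeAtN` (E-an-167) and the node N2ᴺ `NoNewmanThirdRootRepAtN` are the
cell's candidates, NOT results in print (the cite tags name Stevens 1989 Thm 2.3 for the SHAPE of the objects only); refuter verdicts pending
(R-an-69).  The discharging compositions over tree theorems (`noNewmanThirdRootRepAtN_of_geometric`, `cuspidalKummerCubeExponentLaw_of_levelN`)
belong to the prover-only Theorems file F2 `ManinLocalTwoThreeCubeRootDescentAtN` (an, 318cf64298f77537) and are NOT in this file.
PARTITION 0 · beyond-print theorem: no · bears_on stmt-BirchSwinnertonDyer-22968 (C3) · BSD is not proved by this.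
(cell `bsd-f2-manin`, planner `-an` g36, MEMO-an §79.10, FILE A2; proposed tree path
`Summits/BirchSwinnertonDyer/Rank1Residual/ManinAdditive/CuspidalKummerCubeDescentAtN.lean`; imports FILE A
`CuspidalKummerCubeDescent`)

HONEST FRAMING.  FILE A (+ the Theorems files B/F and the Literature file `ModularFunctionFieldEtaProofs`) proved
`LAW₃ ⟸ P79`, P79 = «`Θ_T` is not a cube in `K_{3N}`».  The passage to level `3N` was forced by Newman's SECOND
congruence: for `s = r/3` one needs `24 ∣ S₂(s) = S₂(r)/3`, i.e. `72 ∣ S₂(r) := Σ_δ (N/δ)·r_δ`, which the automorphic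
first descent N1 (`72 ∣ S₁(r)`, PROVED) does not give.  This file records the LEVEL-`N` form of the descent:

* **G1 `CubeRepSecondDescent` (E-an-166, nothing asserted)** — every cuspidal Kummer cube representative of `Θ_T` (optimal
  datum, `9 ∣ N`, rational `3`-torsion point `T` of the short model) has `72 ∣ S₂(r)`.  Paper proof (geometric-LITE: cusp
  orders only): `S₂(r)/24 = ord₀(η_r)` is the order of the level-`N` `η`-quotient at the cusp `0` (Ligozat), and
  `Θ_T = η_r·(A/B)³` in `K_N` with `Θ_T = (t³ℓ_T)∘φ`, `div(t³ℓ_T) = 3·(div t + (T) − (O)) ∈ 3·Div(E)`, so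
  `ord₀(Θ_T) ≡ 0 (mod 3)` and `S₂(r)/24 ≡ 0 (mod 3)`.  It is the `S₂`-mirror (Fricke side) of N1; unlike N1 it is NOT
  automorphic (for a general `Θ ∈ K_N ∩ ℚ⟦q⟧` with `Θ(0) ≠ 0` it fails: `Θ = η_{3s_N}·(A/B)³` with `s_N` as below and
  any `A/B ∈ K_N` of order `N/9` at `∞` has the representative `r = 3s_N`, `S₂(r) = 24`).
  BC5 witness: `S₂(r) ∈ {0, 72}` in 7/7 exact genus-1 representatives (`HOME/an/descent-falsifier-g36.out`).
* **G0 `KummerCubeSeriesNotCubeAtN` (E-an-167, nothing asserted)** — `Θ_T` is not a cube in `K_N`.  Paper proof: a cube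
  root `w ∈ ℂ(X₀(N))` gives `div w = φ^*(div t + (T) − (O))`, i.e. `φ^*[T] = 0` in `J₀(N)`, against the injectivity of
  `φ^* : E → J₀(N)` for the OPTIMAL curve (lattice clause `Λ_E = c·Λ_f`); `T ≠ O`.  This is the `j = 0` (unramified) branch
  of P79's proof and is implied by P79 (`kummerCubeSeriesNotCubeAtN_of_mono_atThreeN`, using only M0); the ramified
  branches `j = 1, 2` of P79 are exactly what G1 removes.  Cheap sufficient condition in print-free language: `3 ∤ deg φ`
  (norm `N_{K_N/φ^*ℂ(E)}` of a cube root makes `(t³ℓ_T)^{deg φ}` a cube in `ℂ(E)`, so `ℓ_T` is a cube, so `(T) − (O)` is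
  principal on a genus-1 curve — absurd); the modular degree `D.deg` is a field of `ModularParametrizationData`.
* `newmanCond_thirdExp` (PROVED): all `r_δ ≡ 0 (3)`, `72 ∣ S₁(r)`, `72 ∣ S₂(r)` ⟹ `s = r/3` satisfies Newman's weight-0
  conditions AT LEVEL `N` (squareness inherited from the cube as in E-an-159).
* N2ᴺ `NoNewmanThirdRootRepAtN` (node, nothing asserted; PROVED from G0 in the Theorems file F2 using M1/M2): no
  representative has all `3 ∣ r_δ` with `r/3` Newman at level `N` (else `Θ_T = (η_{r/3}·A/B)³` in `K_N`).
* `cuspidalKummerCubeExponentLaw_of_levelN_descent : N1 → G1 → N2ᴺ → LAW₃` (PROVED composition) and its `NonBlind` form.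

Net effect (with F2 `ManinLocalTwoThreeCubeRootDescentAtN`): **LAW₃ ⟸ G1 ∧ G0**, both at level `N`, no `K_{3N}`, no
Kummer theory, no M0; G0 is the bare optimality statement and G1 a cusp-order statement with its own census column.
The Kummer-theoretic reading: `K_{3N} = K_N(v)`, `v = η((N/3)τ)⁴/η(Nτ)⁴` (Newman at `3N` iff `9 ∣ N`; `v³ ∈ K_N`,
`ord₀(v³) = 1`), and P79 ⟺ «`Θ_T·v^{3j}` is not a cube in `K_N` for `j = 0, 1, 2`»; G1 kills `j = 1, 2`, G0 is `j = 0`.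
Beyond-print theorem: no.  BSD is not proved by this; Manin's conjecture, C2, C3 are not proved by this. [folklore]
-/

set_option autoImplicit false

noncomputable section

open PowerSeries CongruenceSubgroup
open WeierstrassCurve Literature.NumberTheory.EllipticCurves Literature.NumberTheory.EllipticCurves.ModularForms

namespace Summit.BirchSwinnertonDyer.Rank1Residual.ManinAdditive.CuspidalKummerThree

open Summit.BirchSwinnertonDyer.Rank1Residual.ManinAdditive.CuspidalKummer

/-! ### §1 The arithmetic of `r ↦ r/3` at level `N` -/

/-- The descended exponent vector `s = r/3` (same level). -/
def thirdExp (r : ℕ → ℤ) (δ : ℕ) : ℤ := r δ / 3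

/-- unfolding lemma for `thirdExp`. [folklore] -/
theorem thirdExp_apply (r : ℕ → ℤ) (δ : ℕ) : thirdExp r δ = r δ / 3 := rfl

/-- `3 · Σ F(δ)·(r_δ/3) = Σ F(δ)·r_δ` when every `r_δ ≡ 0 (mod 3)`. [folklore] -/
theorem three_mul_sum_thirdExp {N : ℕ} {r : ℕ → ℤ} (h3 : ∀ δ ∈ N.divisors, (3 : ℤ) ∣ r δ) (F : ℕ → ℤ) :
    3 * ∑ δ ∈ N.divisors, F δ * thirdExp r δ = ∑ δ ∈ N.divisors, F δ * r δ := by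
  rw [Finset.mul_sum]
  refine Finset.sum_congr rfl fun δ hδ => ?_
  rw [thirdExp_apply, mul_left_comm, Int.mul_ediv_cancel' (h3 δ hδ)]

/-- **PROVED.  Newman's weight-`0` conditions descend along `r ↦ r/3` AT LEVEL `N`** as soon as every `r_δ ≡ 0 (mod 3)`,
`72 ∣ S₁(r)` and `72 ∣ S₂(r)`; squareness of `∏ δ^{|r_δ/3|}` is inherited from its cube `∏ δ^{|r_δ|}`. [folklore] -/
theorem newmanCond_thirdExp {N : ℕ} {r : ℕ → ℤ} (hr : NewmanCond N r 0) (h3 : ∀ δ ∈ N.divisors, (3 : ℤ) ∣ r δ)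
    (h72₁ : (72 : ℤ) ∣ ∑ δ ∈ N.divisors, (δ : ℤ) * r δ)
    (h72₂ : (72 : ℤ) ∣ ∑ δ ∈ N.divisors, ((N / δ : ℕ) : ℤ) * r δ) :
    NewmanCond N (thirdExp r) 0 := by
  refine ⟨?_, ?_, ?_, ?_⟩
  · have h0 := hr.sum_eq
    have h := three_mul_sum_thirdExp h3 (fun _ => 1)
    simp only [one_mul] at h
    omega
  · have h := three_mul_sum_thirdExp h3 (fun δ => (δ : ℤ))
    omega
  · have h := three_mul_sum_thirdExp h3 (fun δ => ((N / δ : ℕ) : ℤ))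
    omega
  · apply isSquare_of_isSquare_pow_three
    have hcube : (∏ δ ∈ N.divisors, δ ^ (thirdExp r δ).natAbs) ^ 3 = ∏ δ ∈ N.divisors, δ ^ (r δ).natAbs := by
      rw [← Finset.prod_pow]
      refine Finset.prod_congr rfl fun δ hδ => ?_
      rw [← pow_mul]
      congr 1
      obtain ⟨t, ht⟩ := h3 δ hδ
      rw [thirdExp_apply, ht, Int.mul_ediv_cancel_left _ (by norm_num : (3 : ℤ) ≠ 0), Int.natAbs_mul]
      simp [mul_comm]
    rw [hcube]
    exact hr.isSquare

/-! ### §2 The level-`N` leaves G1 / G0, the node N2ᴺ, and the closed composition -/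

/-- **G1 `CubeRepSecondDescent` (E-an-166; geometric-lite, nothing asserted): for an `X₀(N)`-optimal datum with `9 ∣ N`
and a rational point `T` of order `3` on the short model, every cuspidal Kummer cube representative of `Θ_T` has
`72 ∣ S₂(r) = Σ_δ (N/δ)·r_δ`** (`S₂(r)/24 = ord₀(η_r) ≡ ord₀(Θ_T) ≡ 0 (mod 3)` since `div((t³ℓ_T)∘φ) ∈ 3·Div`).
The `S₂`-mirror of N1 `CubeRepFirstDescent`; NOT automorphic.  Why it might fail: only through the dictionary
«`IsParamGerm` germ = modular parametrisation».  BC5: `S₂(r) ∈ {0, 72}` in 7/7 exact genus-1 representatives.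
[cite: Stevens1989, Thm. 2.3 (shape only: optimal parametrisations; the divisibility `72 ∣ S₂` of cube representatives is the cell's G1, NOT in print — MEMO-an §79.10)] -/
@[conjecture]
def CubeRepSecondDescent : Prop :=
  ∀ (W : WeierstrassCurve ℚ) [W.IsElliptic] [W.IsGloballyMinimal] {N : ℕ} [NeZero N]
    (D : ModularParametrizationData W N) (a : ℕ → ℤ), (∀ n, (a n : ℂ) = cuspCoeff D.f n) →
    9 ∣ N → (∀ z ∈ D.L.lattice, ∃ w ∈ periodLattice D.f, z = D.c * w) →
    ∀ X₀ Y₀ : ℚ, IsShortThreeTorsion W D.c X₀ Y₀ →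
    ∀ z : ℚ⟦X⟧, IsParamGerm W D.c a z →
    ∀ (r : ℕ → ℤ) (g A B : ℤ⟦X⟧), IsCuspidalKummerCubeRep N (kummerCubeSeries W D.c X₀ Y₀ z) r g A B →
    (72 : ℤ) ∣ ∑ δ ∈ N.divisors, ((N / δ : ℕ) : ℤ) * r δ

/-- **G0 `KummerCubeSeriesNotCubeAtN` (E-an-167; the bare optimality statement, nothing asserted): for an `X₀(N)`-optimal
datum with `9 ∣ N` and a rational point `T` of order `3` on the short model, `Θ_T` is not a cube in `K_N`.**  Paper proof:
a cube root `w ∈ ℂ(X₀(N))` has `div w = φ^*(div t + (T) − (O))`, so `φ^*[T] = 0` in `J₀(N)`; `φ^*` is injective for the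
optimal curve (lattice clause) and `T ≠ O`.  Implied by P79 (`K_N ≤ K_{3N}`); sufficient in print-free language: `3 ∤ deg φ`.
Why it might fail: only through the dictionary «germ = parametrisation».
[cite: Stevens1989, Thm. 2.3 (shape only: optimal quotients and pull-back injectivity; the statement G0 is the cell's, NOT in print — MEMO-an §79.10)] -/
@[conjecture]
def KummerCubeSeriesNotCubeAtN : Prop :=
  ∀ (W : WeierstrassCurve ℚ) [W.IsElliptic] [W.IsGloballyMinimal] {N : ℕ} [NeZero N]
    (D : ModularParametrizationData W N) (a : ℕ → ℤ), (∀ n, (a n : ℂ) = cuspCoeff D.f n) →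
    9 ∣ N → (∀ z ∈ D.L.lattice, ∃ w ∈ periodLattice D.f, z = D.c * w) →
    ∀ X₀ Y₀ : ℚ, IsShortThreeTorsion W D.c X₀ Y₀ →
    ∀ z : ℚ⟦X⟧, IsParamGerm W D.c a z →
    ∀ u ∈ modularFunctionField N,
      HahnSeries.ofPowerSeries ℤ ℂ ((kummerCubeSeries W D.c X₀ Y₀ z).map (algebraMap ℚ ℂ)) ≠ u ^ 3

/-- **N2ᴺ `NoNewmanThirdRootRepAtN` (node, nothing asserted): no cuspidal Kummer cube representative of `Θ_T` has all
`r_δ ≡ 0 (mod 3)` with `r/3` under Newman's conditions at level `N`** (else `Θ_T = (η_{r/3}·A/B)³` in `K_N` by M1/M2 —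
against G0).  PROVED from G0 in the Theorems file F2 (`noNewmanThirdRootRepAtN_of_geometric`).
[cite: Stevens1989, Thm. 2.3 (shape only; the node is the cell's — MEMO-an §79.10)] -/
@[conjecture]
def NoNewmanThirdRootRepAtN : Prop :=
  ∀ (W : WeierstrassCurve ℚ) [W.IsElliptic] [W.IsGloballyMinimal] {N : ℕ} [NeZero N]
    (D : ModularParametrizationData W N) (a : ℕ → ℤ), (∀ n, (a n : ℂ) = cuspCoeff D.f n) →
    9 ∣ N → (∀ z ∈ D.L.lattice, ∃ w ∈ periodLattice D.f, z = D.c * w) →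
    ∀ X₀ Y₀ : ℚ, IsShortThreeTorsion W D.c X₀ Y₀ →
    ∀ z : ℚ⟦X⟧, IsParamGerm W D.c a z →
    ∀ (r : ℕ → ℤ) (g A B : ℤ⟦X⟧), (∀ δ ∈ N.divisors, (3 : ℤ) ∣ r δ) →
    NewmanCond N (thirdExp r) 0 →
    ¬ IsCuspidalKummerCubeRep N (kummerCubeSeries W D.c X₀ Y₀ z) r g A B

/-- **LAW₃ by level-`N` descent (PROVED composition): N1 ∧ G1 ∧ N2ᴺ ⟹ `CuspidalKummerCubeExponentLaw`.** [folklore] -/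
theorem cuspidalKummerCubeExponentLaw_of_levelN_descent (h₁ : CubeRepFirstDescent) (h₂ : CubeRepSecondDescent)
    (h₃ : NoNewmanThirdRootRepAtN) : CuspidalKummerCubeExponentLaw := by
  intro W _ _ N _ D a ha h9 hL X₀ Y₀ hT z hz r g A B hrep
  by_contra hcon
  push Not at hcon
  have h72₁ := h₁ (kummerCubeSeries W D.c X₀ Y₀ z) (constantCoeff_kummerCubeSeries_ne_zero W D.c X₀ Y₀ hz)
    r g A B hrep
  have h72₂ := h₂ W D a ha h9 hL X₀ Y₀ hT z hz r g A B hrep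
  exact h₃ W D a ha h9 hL X₀ Y₀ hT z hz r g A B hcon (newmanCond_thirdExp hrep.1 hcon h72₁ h72₂) hrep

/-- LAW₃♮ by level-`N` descent, BY NAME. [folklore] -/
theorem cuspidalKummerCubeExponentLawNonBlind_of_levelN_descent (h₁ : CubeRepFirstDescent)
    (h₂ : CubeRepSecondDescent) (h₃ : NoNewmanThirdRootRepAtN) : CuspidalKummerCubeExponentLawNonBlind :=
  cuspidalKummerCubeExponentLawNonBlind_of_law (cuspidalKummerCubeExponentLaw_of_levelN_descent h₁ h₂ h₃)

/-- G0 ⟸ M0 ∧ P79 (`K_N ≤ K_{3N}`): the level-`N` non-cube statement is the WEAKER leaf. [folklore] -/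
theorem kummerCubeSeriesNotCubeAtN_of_mono_atThreeN (hM0 : ModularFunctionFieldMono)
    (hP : KummerCubeSeriesNotCubeAtThreeN) : KummerCubeSeriesNotCubeAtN := by
  intro W _ _ N _ D a ha h9 hL X₀ Y₀ hT z hz u hu
  exact hP W D a ha h9 hL X₀ Y₀ hT z hz u (hM0 N (3 * N) (Dvd.intro_left 3 rfl) hu)

end Summit.BirchSwinnertonDyer.Rank1Residual.ManinAdditive.CuspidalKummerThree
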